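import Literature.Probability.Percolation.PortRuns
import HarnessLib

/-!
# Counting the ports of the link domain

Topic `Probability/Percolation`.  Support file (definitions and proofs, no named fact) for step (C)
of the proof of Schramm–Smirnov's Prop. 4.1 (Ann. Probab. 39 (2011), §4, "the number of bays is
bounded on the complement of GOOD"), in the language of tile domains.  When every vertex outside
the window is a hub vertex and every edge leaving the window is examined (as for the zones of the
gluing argument), the out-cells of the traced loop of `U` are hub, closed or pocket cells only
(`out_classification'`), and a closed contact is followed by an open one only at a **landing**: the
corner of an accessible edge with a hub endpoint and a wet face (`transition`).  Consequently the
number of maximal open stretches over a period of the loop, hence (by the port theorem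
`hubConn_of_open_stretch`) the number of hubs owning the hub contacts, is at most twice the number
of landing edges (`exists_owners`).

## References

* O. Schramm, S. Smirnov, *On the scaling limits of planar percolation*, Ann. Probab. 39 (2011)
  1768–1814, arXiv:1101.5820, §4, proof of Prop. 4.1. [SchrammSmirnov2011]
-/

noncomputable section

open Set Relation
open Literature.Probability.LatticeModels
open scoped Classical

namespace Literature.Probability.Percolation

namespace CellComplex

/-- **A dart is determined by its two cells**: the cells on the left and on the right of the unit
segment. [folklore] -/
theorem dart_eq_of_faceAt_eq {v v' : Site 2} {k k' : Fin 4} (hL : faceAt v k = faceAt v' k')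
    (hR : faceAt v (k + 3) = faceAt v' (k' + 3)) : v = v' ∧ k = k' := by
  simp only [faceAt] at hL hR
  have hdiff : cornerOff k - cornerOff (k + 3) = cornerOff k' - cornerOff (k' + 3) := by
    have h1 := sub_eq_sub_iff_sub_eq_sub.1 hL
    have h2 := sub_eq_sub_iff_sub_eq_sub.1 hR
    -- `v - v' = cornerOff k - cornerOff k'` and `v - v' = cornerOff (k+3) - cornerOff (k'+3)`
    have := h1.symm.trans h2
    -- rearrange
    have e : cornerOff k - cornerOff k' - (cornerOff (k + 3) - cornerOff (k' + 3)) = 0 := sub_eq_zero.2 this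
    have : cornerOff k - cornerOff (k + 3) - (cornerOff k' - cornerOff (k' + 3)) = 0 := by rw [← e]; abel
    exact sub_eq_zero.1 this
  have key : ∀ a b : Fin 4, cornerOff a - cornerOff (a + 3) = cornerOff b - cornerOff (b + 3) → a = b := by decide
  have hk : k = k' := key k k' hdiff
  subst hk
  exact ⟨sub_left_injective hL, rfl⟩

namespace TileData

variable {𝒯 : TileData} {d₀ : Site 2 × Fin 4}

/-! ### No exterior contacts when the outside of the window is explored -/

section Explored

variable (hT : 𝒯.Terminal) (hfarO : ∀ u, u ∉ 𝒯.Wv → u ∈ 𝒯.O)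
  (hX : ∀ e ∈ (zdGraph 2).edgeSet, (∃ v ∈ e, v ∈ 𝒯.Wv) → (∃ u ∈ e, u ∉ 𝒯.Wv) → e ∈ 𝒯.hubE ∨ e ∈ 𝒯.clE)
  (hdisj : ∀ e ∈ 𝒯.hubE, e ∉ 𝒯.clE)
include hT hfarO hX

/-- **Out-cells are hub, closed or pocket cells** when every vertex outside the window is a hub
vertex and every edge leaving the window is examined. [folklore] -/
theorem out_classification' {d : Site 2 × Fin 4} (hd : IsBd 𝒯.U d) :
    𝒯.IsHubCell (faceAt d.1 (d.2 + 3)) ∨ 𝒯.IsClosedCell (faceAt d.1 (d.2 + 3)) ∨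
      (𝒯.IsPocketCell (faceAt d.1 (d.2 + 3)) ∧ ∃ f, faceAt d.1 d.2 = φc f) := by
  rcases out_classification hd with h | h | h | ⟨y, m, hc, hW⟩
  · exact Or.inl h
  · exact Or.inr (Or.inl h)
  · exact Or.inr (Or.inr h)
  · -- an exterior bond cell: its edge is examined, or both endpoints are far hub vertices
    set e := dartEdge y m with he
    by_cases hwin : ∃ v ∈ e, v ∈ 𝒯.Wv
    · have hout : ∃ u ∈ e, u ∉ 𝒯.Wv := by
        rcases hW with h' | h'
        · exact ⟨y, mem_dartEdge_iff.2 (Or.inl rfl), h'⟩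
        · exact ⟨_, mem_dartEdge_iff.2 (Or.inr rfl), h'⟩
      rcases hX e (dartEdge_mem_edgeSet _ _) hwin hout with h' | h'
      · exact Or.inl (Or.inr ⟨y, m, h', hc⟩)
      · exact Or.inr (Or.inl (Or.inl ⟨e, h', dartEdge_mem_edgeSet _ _, by rw [hc, he, bcell_dartEdge]⟩))
    · -- both endpoints outside the window: the in-cell touches a far hub vertex, so it is wet
      push Not at hwin
      have hyW : y ∉ 𝒯.Wv := hwin y (mem_dartEdge_iff.2 (Or.inl rfl))
      have hyO : y ∈ 𝒯.O := hfarO y hyW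
      exfalso
      -- the in-cell is in `U` and shares a side with `βc y m`; it touches `y` or `y + e_m`
      obtain ⟨hin, hout⟩ := hd
      rw [hc] at hout
      -- classify the in-cell among the cells around the corners of `βc y m`: use `out_classification`'s
      -- corner bookkeeping through `exists_corner_eq`
      obtain ⟨v, k⟩ := d
      simp only at hin hout hc ⊢
      obtain ⟨y', j', rfl⟩ := exists_corner_eq v
      obtain ⟨t, rfl⟩ := fin4_exists_add j' k
      rcases (show t = 0 ∨ t = 1 ∨ t = 2 ∨ t = 3 by fin_cases t <;> simp) with rfl | rfl | rfl | rfl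
      · rw [add_zero, faceAt_corner_self] at hin
        rw [add_zero, faceAt_corner_add_three] at hc
        -- in-cell `σ y'` accessible, out-cell `β y' (j'+3)` = `β y m`: `y' ∈ e`, `y' ∈ Wv`
        obtain ⟨-, a, ha, hya⟩ := (σc_mem_U_iff 𝒯).1 hin
        have : y' ∈ e := by
          have h1 : dartEdge y' (j' + 3) = e :=
            bcell_injOn (dartEdge_mem_edgeSet _ _) (dartEdge_mem_edgeSet _ _) (by rw [bcell_dartEdge, bcell_dartEdge, hc])
          rw [← h1]; exact mem_dartEdge_iff.2 (Or.inl rfl)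
        exact hwin y' this (𝒯.acc_window a ha y' hya)
      · rw [faceAt_corner_add_one] at hin
        rw [fin4_add_one_add_three, faceAt_corner_self] at hc
        exact σc_ne_βc y' y m hc
      · rw [faceAt_corner_add_two] at hin
        rw [fin4_add_two_add_three, faceAt_corner_add_one] at hc
        -- in-cell `φ f` with `f = faceAt y' (j'+2)` dry; the out edge `dartEdge y' (j'+2) = e` has corner `y'`
        obtain ⟨hfD, -⟩ := (φc_mem_U_iff 𝒯).1 hin
        have h1 : dartEdge y' (j' + 2) = e :=
          bcell_injOn (dartEdge_mem_edgeSet _ _) (dartEdge_mem_edgeSet _ _) (by rw [bcell_dartEdge, bcell_dartEdge, hc])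
        have hy'W : y' ∉ 𝒯.Wv := hwin y' (h1 ▸ mem_dartEdge_iff.2 (Or.inl rfl))
        exact hfD (hT.far_wet y' _ (hfarO y' hy'W) hy'W (touchesFace_iff_exists_faceAt.2 ⟨j' + 2, rfl⟩))
      · rw [faceAt_corner_add_three] at hin
        rw [fin4_add_three_add_three, faceAt_corner_add_two] at hc
        exact βc_ne_φc y _ m hc.symm

omit hT hfarO hX in
/-- A closed face cell is a wet face. [folklore] -/
theorem mem_Dset_of_isClosedCell_φc {f : Site 2} (h : 𝒯.IsClosedCell (φc f)) : f ∈ 𝒯.Dset := by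
  rcases h with ⟨e, -, heE, hc⟩ | ⟨f', hf', hc⟩
  · obtain ⟨m, hm⟩ := exists_eq_dartEdge_of_mem heE (Sym2.out_fst_mem e)
    rw [hm, bcell_dartEdge] at hc
    exact absurd hc.symm (βc_ne_φc _ f m)
  · rwa [φc_injective hc]

omit hT hfarO hX in
/-- A closed bond cell is an examined closed edge. [folklore] -/
theorem mem_clE_of_isClosedCell_βc {y : Site 2} {m : Fin 4} (h : 𝒯.IsClosedCell (βc y m)) : dartEdge y m ∈ 𝒯.clE := by
  rcases h with ⟨e, he, heE, hc⟩ | ⟨f', -, hc⟩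
  · have : e = dartEdge y m := bcell_injOn heE (dartEdge_mem_edgeSet _ _) (by rw [← hc, bcell_dartEdge])
    exact this ▸ he
  · exact absurd hc (βc_ne_φc y f' m)

omit hT hfarO hX in
/-- A site cell is not a closed cell. [folklore] -/
theorem not_isClosedCell_σc (v : Site 2) : ¬ 𝒯.IsClosedCell (σc v) := by
  rintro (⟨e, -, heE, hc⟩ | ⟨f', -, hc⟩)
  · obtain ⟨m, hm⟩ := exists_eq_dartEdge_of_mem heE (Sym2.out_fst_mem e)
    rw [hm, bcell_dartEdge] at hc
    exact σc_ne_βc v _ m hc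
  · exact σc_ne_φc v f' hc

include hdisj in
omit hT hfarO hX in
/-- A closed cell is neither a hub cell nor a pocket cell. [folklore] -/
theorem not_open_of_isClosedCell {c : Site 2} (h : 𝒯.IsClosedCell c) : ¬ 𝒯.IsHubCell c ∧ ¬ 𝒯.IsPocketCell c := by
  constructor
  · intro hh
    rcases hh with ⟨v, -, rfl⟩ | ⟨y, m, hhub, rfl⟩
    · exact not_isClosedCell_σc v h
    · exact hdisj _ hhub (mem_clE_of_isClosedCell_βc h)
  · intro hp
    exact hp.not_isClosedCell h

omit hT hfarO hX in
/-- At an accessible non-hub vertex no bond cell is a hub cell or a pocket cell. [folklore] -/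
theorem not_open_βc_of_accessible {y : Site 2} (hyO : y ∉ 𝒯.O) {a : Sym2 (Site 2)} (ha : a ∈ 𝒯.acc) (hya : y ∈ a)
    (m : Fin 4) : ¬ 𝒯.IsHubCell (βc y m) ∧ ¬ 𝒯.IsPocketCell (βc y m) := by
  constructor
  · intro h
    exact hyO (𝒯.hub_O _ (𝒯.mem_hubE_of_isHubCell_βc h) y (mem_dartEdge_iff.2 (Or.inl rfl)))
  · rintro ⟨y', m', hc, hhub, hcl, hacc, hW, hW'⟩
    have he : dartEdge y m = dartEdge y' m' :=
      bcell_injOn (dartEdge_mem_edgeSet _ _) (dartEdge_mem_edgeSet _ _) (by rw [bcell_dartEdge, bcell_dartEdge, hc])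
    have hwin : ∀ v ∈ dartEdge y m, v ∈ 𝒯.Wv := by
      rw [he]; intro v hv
      rcases mem_dartEdge_iff.1 hv with rfl | rfl <;> assumption
    rcases 𝒯.closure a ha y hya hyO _ (dartEdge_mem_edgeSet y m) (mem_dartEdge_iff.2 (Or.inl rfl)) hwin with h | h | h
    · exact hhub (he ▸ h)
    · exact hcl (he ▸ h)
    · exact hacc (he ▸ h)

omit hT hfarO hX in
/-- At a corner of an accessible site cell, no cell outside `U` is a hub cell or a pocket cell.
[folklore] -/
theorem not_open_of_σc_mem {y : Site 2} {j : Fin 4} (hσ : σc y ∈ 𝒯.U) (r : Fin 4)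
    (hY : faceAt (σc y + cornerOff j) r ∉ 𝒯.U) :
    ¬ (𝒯.IsHubCell (faceAt (σc y + cornerOff j) r) ∨ 𝒯.IsPocketCell (faceAt (σc y + cornerOff j) r)) := by
  obtain ⟨hyO, a, ha, hya⟩ := (σc_mem_U_iff 𝒯).1 hσ
  obtain ⟨t, rfl⟩ := fin4_exists_add j r
  rcases (show t = 0 ∨ t = 1 ∨ t = 2 ∨ t = 3 by fin_cases t <;> simp) with rfl | rfl | rfl | rfl
  · rw [add_zero, faceAt_corner_self] at hY; exact absurd hσ hY
  · rw [faceAt_corner_add_one]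
    exact not_or.2 (not_open_βc_of_accessible hyO ha hya _)
  · rw [faceAt_corner_add_two]
    rintro (h | ⟨y', m', hc, -⟩)
    · exact 𝒯.not_isHubCell_φc _ h
    · exact βc_ne_φc y' _ m' hc.symm
  · rw [faceAt_corner_add_three]
    exact not_or.2 (not_open_βc_of_accessible hyO ha hya _)

omit hT hfarO hX in
/-- **The transition lemma.**  If the `i`-th out-cell of the loop is a closed cell and the
`(i+1)`-st is a hub or pocket cell, then the tracing turns left at the corner `vert (i+1) = 2y +
cornerOff j` around the bond cell of an accessible edge `a = {y, y + e_{j+2}}` at the hub vertex `y`,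
and the `i`-th out-cell is the (wet) face `faceAt y (j+2)` of `a`: a **landing**. [folklore] -/
theorem transition {i : ℕ} (hcl : 𝒯.IsClosedCell (𝒯.outCell d₀ i))
    (hop : 𝒯.hubContact d₀ (i + 1) ∨ 𝒯.IsPocketCell (𝒯.outCell d₀ (i + 1))) (h₀ : IsBd 𝒯.U d₀) :
    ∃ y j, vert 𝒯.U d₀ (i + 1) = σc y + cornerOff j ∧ dartEdge y (j + 2) ∈ 𝒯.acc ∧ y ∈ 𝒯.O ∧
      faceAt y (j + 2) ∈ 𝒯.Dset ∧ faceAt (vert 𝒯.U d₀ i) (dirAt 𝒯.U d₀ i) = βc y (j + 2) ∧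
      𝒯.outCell d₀ i = φc (faceAt y (j + 2)) := by
  obtain ⟨y, j, hq⟩ := exists_corner_eq (vert 𝒯.U d₀ (i + 1))
  set k := dirAt 𝒯.U d₀ i with hk
  have hin : faceAt (vert 𝒯.U d₀ i) k = faceAt (vert 𝒯.U d₀ (i + 1)) (k + 1) := by
    rw [vert_succ, ← hk, faceAt_add_unit_succ]
  have hout : 𝒯.outCell d₀ i = faceAt (vert 𝒯.U d₀ (i + 1)) (k + 2) := by
    rw [TileData.outCell, vert_succ, ← hk, faceAt_add_unit_add_two]
  have hinU : faceAt (vert 𝒯.U d₀ i) k ∈ 𝒯.U := (isBd_bdOrbit h₀ i).1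
  have hY : 𝒯.outCell d₀ (i + 1) ∉ 𝒯.U := (isBd_bdOrbit h₀ (i + 1)).2
  rw [hq] at hin hout
  obtain ⟨r, hr⟩ := fin4_exists_add j (k + 1)
  rw [hr] at hin
  rw [show k + 2 = k + 1 + 1 from (fin4_add_one_add_one k).symm, hr] at hout
  rcases (show r = 0 ∨ r = 1 ∨ r = 2 ∨ r = 3 by fin_cases r <;> simp) with rfl | rfl | rfl | rfl
  · -- in-cell `σ y`: no open cell at this corner
    rw [add_zero, faceAt_corner_self] at hin
    exfalso
    rw [hin] at hinU
    have := not_open_of_σc_mem hinU (dirAt 𝒯.U d₀ (i + 1) + 3) (by rwa [← hq])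
    rw [← hq] at this
    exact this hop
  · -- in-cell `β y (j+2)`: the landing
    rw [faceAt_corner_add_one] at hin
    rw [fin4_add_one_add_one, faceAt_corner_add_two] at hout
    have hacc : dartEdge y (j + 2) ∈ 𝒯.acc := (βc_mem_U_iff 𝒯).1 (hin ▸ hinU)
    have hD : faceAt y (j + 2) ∈ 𝒯.Dset := mem_Dset_of_isClosedCell_φc (hout ▸ hcl)
    have hyO : y ∈ 𝒯.O := by
      by_contra hyO
      have hσ : σc y ∈ 𝒯.U := (σc_mem_U_iff 𝒯).2 ⟨hyO, _, hacc, mem_dartEdge_iff.2 (Or.inl rfl)⟩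
      have := not_open_of_σc_mem hσ (dirAt 𝒯.U d₀ (i + 1) + 3) (by rwa [← hq])
      rw [← hq] at this
      exact this hop
    exact ⟨y, j, hq, hacc, hyO, hD, hin, hout⟩
  · -- in-cell `φ (faceAt y (j+2))` dry, out-cell the closed bond `β y (j+3)`: its faces are wet
    rw [faceAt_corner_add_two] at hin
    rw [fin4_add_two_add_one, faceAt_corner_add_three] at hout
    exfalso
    obtain ⟨hfD, -⟩ := (φc_mem_U_iff 𝒯).1 (hin ▸ hinU)
    have hclE := mem_clE_of_isClosedCell_βc (hout ▸ hcl)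
    exact hfD (𝒯.cl_D _ hclE _ (isFaceOf_dartEdge_iff.2 (Or.inr (by rw [fin4_add_three_add_three]))))
  · -- out-cell `σ y` is not closed
    rw [fin4_add_three_add_one, faceAt_corner_self] at hout
    exact absurd (hout ▸ hcl) (not_isClosedCell_σc y)

end Explored

/-! ### Periodicity of the contacts -/

section Periodic

variable (h₀ : IsBd 𝒯.U d₀)
include h₀

/-- The out-cells are periodic. [folklore] -/
theorem outCell_add_period (i : ℕ) : 𝒯.outCell d₀ (i + period h₀) = 𝒯.outCell d₀ i := by
  simp only [TileData.outCell, vert, dirAt, bdOrbit_add_period h₀]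

/-- The out-cells are periodic (multiples). [folklore] -/
theorem outCell_add_mul_period (i q : ℕ) : 𝒯.outCell d₀ (i + q * period h₀) = 𝒯.outCell d₀ i := by
  induction q with
  | zero => simp
  | succ q ih => rw [Nat.succ_mul, ← add_assoc, outCell_add_period h₀, ih]

/-- The in-cells are periodic (multiples). [folklore] -/
theorem inCell_add_mul_period (i q : ℕ) :
    faceAt (vert 𝒯.U d₀ (i + q * period h₀)) (dirAt 𝒯.U d₀ (i + q * period h₀)) = faceAt (vert 𝒯.U d₀ i) (dirAt 𝒯.U d₀ i) := by
  induction q with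
  | zero => simp
  | succ q ih => rw [Nat.succ_mul, ← add_assoc]; simp only [vert, dirAt, bdOrbit_add_period h₀] at ih ⊢; exact ih

end Periodic

/-! ### Counting the transitions -/

section Count

variable (h₀ : IsBd 𝒯.U d₀) (hT : 𝒯.Terminal) (hfarO : ∀ u, u ∉ 𝒯.Wv → u ∈ 𝒯.O)
  (hX : ∀ e ∈ (zdGraph 2).edgeSet, (∃ v ∈ e, v ∈ 𝒯.Wv) → (∃ u ∈ e, u ∉ 𝒯.Wv) → e ∈ 𝒯.hubE ∨ e ∈ 𝒯.clE)
  (hdisj : ∀ e ∈ 𝒯.hubE, e ∉ 𝒯.clE)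
  (hfar : ∀ c c' u₁ u₂ : Site 2, c ∈ 𝒯.O → c' ∈ 𝒯.O → (∃ f, TouchesFace c f ∧ TouchesFace c' f) →
    u₁ ∉ 𝒯.Wv → u₂ ∉ 𝒯.Wv → ReflTransGen (fun a b => s(a, b) ∈ 𝒯.hubE) c u₁ →
    ReflTransGen (fun a b => s(a, b) ∈ 𝒯.hubE) c' u₂ → ReflTransGen (FarAdj 𝒯) u₂ u₁)

variable (𝒯 d₀) in
/-- **Open sides**: hub contacts and pocket contacts. [folklore] -/
def IsOpenSide (i : ℕ) : Prop := 𝒯.hubContact d₀ i ∨ 𝒯.IsPocketCell (𝒯.outCell d₀ i)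

variable (𝒯) in
/-- **Landing edges**: accessible edges with a hub endpoint and a wet face. [cite: SchrammSmirnov2011, §4, proof of Prop. 4.1 (the legs of the interfaces on β')] -/
def landings : Finset (Sym2 (Site 2)) :=
  𝒯.acc.filter fun a => (∃ y ∈ a, y ∈ 𝒯.O) ∧ ∃ f, IsFaceOf f a ∧ f ∈ 𝒯.Dset

variable (𝒯 d₀) in
/-- **Transitions**: indices in a period where a closed contact is followed by an open one. [folklore] -/
def transitions (h₀ : IsBd 𝒯.U d₀) : Finset ℕ :=
  (Finset.range (period h₀)).filter fun i => 𝒯.IsClosedCell (𝒯.outCell d₀ i) ∧ 𝒯.IsOpenSide d₀ (i + 1)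

/-- The endpoint finset of an edge has at most two elements. [folklore] -/
theorem card_facesOf_le (e : Sym2 (Site 2)) : (facesOf e).card ≤ 2 := by
  unfold facesOf
  induction dualEdge e using Sym2.ind with
  | h a b =>
    show (endpts s(a, b)).card ≤ 2
    simp only [endpts, Sym2.lift_mk]
    exact Finset.card_le_two

include h₀ in
/-- **At most two transitions per landing edge.** [folklore] -/
theorem card_transitions_le : (𝒯.transitions d₀ h₀).card ≤ 2 * (𝒯.landings).card := by
  classical
  -- the pair (in-cell, out-cell) of a transition side determines the side, and is (bond cell of a
  -- landing edge, face cell of one of its faces)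
  set g : ℕ → Site 2 × Site 2 := fun i => (faceAt (vert 𝒯.U d₀ i) (dirAt 𝒯.U d₀ i), 𝒯.outCell d₀ i) with hg
  set S : Finset (Site 2 × Site 2) := 𝒯.landings.biUnion fun a => (facesOf a).image fun f => (bcell a, φc f) with hS
  have hinj : Set.InjOn g (𝒯.transitions d₀ h₀ : Set ℕ) := by
    intro i hi i' hi' hgi
    simp only [hg, Prod.mk.injEq, TileData.outCell] at hgi
    have hii := bdOrbit_injOn h₀ (Finset.mem_range.1 (Finset.mem_filter.1 hi).1) (Finset.mem_range.1 (Finset.mem_filter.1 hi').1)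
    apply hii
    obtain ⟨h1, h2⟩ := dart_eq_of_faceAt_eq hgi.1 hgi.2
    exact Prod.ext h1 h2
  have hmaps : ∀ i ∈ 𝒯.transitions d₀ h₀, g i ∈ S := by
    intro i hi
    obtain ⟨-, hcl, hop⟩ := Finset.mem_filter.1 hi
    obtain ⟨y, j, -, hacc, hyO, hD, hin, hout⟩ := transition hcl hop h₀
    simp only [hS, Finset.mem_biUnion, Finset.mem_image, mem_facesOf_iff]
    refine ⟨dartEdge y (j + 2), Finset.mem_filter.2 ⟨hacc, ⟨y, mem_dartEdge_iff.2 (Or.inl rfl), hyO⟩, _,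
      isFaceOf_dartEdge_iff.2 (Or.inl rfl), hD⟩, faceAt y (j + 2), isFaceOf_dartEdge_iff.2 (Or.inl rfl), ?_⟩
    simp only [hg, hin, hout, bcell_dartEdge]
  calc (𝒯.transitions d₀ h₀).card ≤ S.card := Finset.card_le_card_of_injOn g hmaps hinj
    _ ≤ ∑ a ∈ 𝒯.landings, ((facesOf a).image fun f => (bcell a, φc f)).card := Finset.card_biUnion_le
    _ ≤ ∑ a ∈ 𝒯.landings, 2 := Finset.sum_le_sum fun a _ => (Finset.card_image_le.trans (card_facesOf_le a))
    _ = 2 * (𝒯.landings).card := by rw [Finset.sum_const, smul_eq_mul, mul_comm]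

include h₀ hT hfarO hX in
/-- Every side is open or closed. [folklore] -/
theorem isOpenSide_or_isClosedCell (i : ℕ) : 𝒯.IsOpenSide d₀ i ∨ 𝒯.IsClosedCell (𝒯.outCell d₀ i) := by
  rcases out_classification' hT hfarO hX (isBd_bdOrbit h₀ i) with h | h | ⟨h, -⟩
  · exact Or.inl (Or.inl h)
  · exact Or.inr h
  · exact Or.inl (Or.inr h)

include h₀ hT hfarO hX hdisj hfar in
/-- **The owners of the hub contacts are few.**  There is a set `R` of at most
`max 1 (2 · #landings)` hub vertices such that every vertex attached to a hub contact of the loop is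
joined by examined open edges to a vertex of `R`. [cite: SchrammSmirnov2011, §4, proof of Prop. 4.1 ("the number of bays is bounded")] -/
theorem exists_owners : ∃ R : Finset (Site 2), R.card ≤ max 1 (2 * (𝒯.landings).card) ∧
    ∀ i, 𝒯.hubContact d₀ i → ∀ v ∈ 𝒯.att (𝒯.outCell d₀ i), ∃ r ∈ R, 𝒯.HubConn v r := by
  classical
  have hP0 : 0 < period h₀ := period_pos h₀
  -- periodicity of the predicates
  have hout_per : ∀ i q, 𝒯.outCell d₀ (i + q * (period h₀)) = 𝒯.outCell d₀ i := outCell_add_mul_period h₀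
  have hhub_per : ∀ i q, 𝒯.hubContact d₀ (i + q * (period h₀)) ↔ 𝒯.hubContact d₀ i := fun i q => by
    simp only [TileData.hubContact, hout_per]
  have hopen_per : ∀ i q, 𝒯.IsOpenSide d₀ (i + q * (period h₀)) ↔ 𝒯.IsOpenSide d₀ i := fun i q => by
    simp only [IsOpenSide, TileData.hubContact, hout_per]
  have hcl_per : ∀ i q, 𝒯.IsClosedCell (𝒯.outCell d₀ (i + q * (period h₀))) ↔ 𝒯.IsClosedCell (𝒯.outCell d₀ i) := fun i q => by
    rw [hout_per]
  by_cases hall : ∀ i, i < (period h₀) → 𝒯.IsOpenSide d₀ i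
  · -- no closed contact at all: one owner
    have hopen : ∀ i, 𝒯.IsOpenSide d₀ i := by
      intro i
      have := hall (i % (period h₀)) (Nat.mod_lt _ hP0)
      rwa [← hopen_per (i % (period h₀)) (i / (period h₀)), Nat.mod_add_div'] at this
    by_cases hex : ∃ i, 𝒯.hubContact d₀ i
    · obtain ⟨i₁, hi₁⟩ := hex
      obtain ⟨w, hw⟩ := 𝒯.att_nonempty hi₁
      refine ⟨{w}, by simp, fun i hi v hv => ⟨w, Finset.mem_singleton_self _, ?_⟩⟩
      rcases le_total i i₁ with h | h
      · exact hubConn_of_open_stretch' h₀ hT hfar h (fun l _ _ => hopen l) hi hi₁ hv hw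
      · exact (hubConn_of_open_stretch' h₀ hT hfar h (fun l _ _ => hopen l) hi₁ hi hw hv).symm
    · push Not at hex
      exact ⟨∅, by simp, fun i hi => absurd hi (hex i)⟩
  · -- there is a closed contact `i₁ < (period h₀)`
    push Not at hall
    obtain ⟨i₁, hi₁P, hi₁⟩ := hall
    have hcl₁ : 𝒯.IsClosedCell (𝒯.outCell d₀ i₁) :=
      (isOpenSide_or_isClosedCell h₀ hT hfarO hX i₁).resolve_left hi₁
    -- the representative of a transition: a vertex attached to the first hub contact of its stretch
    let good : ℕ → Prop := fun t => ∃ n, t < n ∧ 𝒯.hubContact d₀ n ∧ ∀ j, t < j → j ≤ n → 𝒯.IsOpenSide d₀ j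
    let rep : ℕ → Site 2 := fun t =>
      if h : good t then (𝒯.att_nonempty (Nat.find_spec h).2.1).choose else 0
    refine ⟨(𝒯.transitions d₀ h₀).image rep, ?_, ?_⟩
    · exact (Finset.card_image_le.trans (card_transitions_le h₀)).trans (le_max_right _ _)
    · intro i hi v hv
      -- normalise the index into `[P, 2P)`: `i = r + k P`, `n₀ := r + P`
      obtain ⟨r, k, hrP, hik⟩ : ∃ r k, r < period h₀ ∧ i = r + k * period h₀ :=
        ⟨i % period h₀, i / period h₀, Nat.mod_lt _ hP0, (Nat.mod_add_div' i _).symm⟩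
      obtain ⟨n₀, hn₀⟩ : ∃ n₀, n₀ = r + 1 * period h₀ := ⟨_, rfl⟩
      have hi' : 𝒯.hubContact d₀ n₀ := by rw [hn₀, hhub_per, ← hhub_per r k, ← hik]; exact hi
      have hv' : v ∈ 𝒯.att (𝒯.outCell d₀ n₀) := by rw [hn₀, hout_per, ← hout_per r k, ← hik]; exact hv
      -- the last closed side `c` before `n₀`, within one period
      have hexc : ∃ c, c < n₀ ∧ n₀ ≤ c + period h₀ ∧ 𝒯.IsClosedCell (𝒯.outCell d₀ c) := by
        by_cases hlt : r ≤ i₁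
        · exact ⟨i₁, by omega, by omega, hcl₁⟩
        · refine ⟨i₁ + 1 * period h₀, by omega, by omega, ?_⟩
          rw [hcl_per]; exact hcl₁
      set c := Nat.findGreatest (fun c => 𝒯.IsClosedCell (𝒯.outCell d₀ c)) (n₀ - 1) with hc
      obtain ⟨c₁, hc₁lt, hc₁le, hc₁cl⟩ := hexc
      have hcle : c ≤ n₀ - 1 := Nat.findGreatest_le _
      have hc₁c : c₁ ≤ c := Nat.le_findGreatest (by omega) hc₁cl
      have hccl : 𝒯.IsClosedCell (𝒯.outCell d₀ c) :=
        Nat.findGreatest_spec (P := fun c => 𝒯.IsClosedCell (𝒯.outCell d₀ c)) (by omega) hc₁cl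
      have hopen_after : ∀ j, c < j → j ≤ n₀ → 𝒯.IsOpenSide d₀ j := by
        intro j hcj hjn
        rcases (isOpenSide_or_isClosedCell h₀ hT hfarO hX j) with h | h
        · exact h
        · exfalso
          rcases Nat.lt_or_ge j n₀ with hjn' | hjn'
          · have := Nat.le_findGreatest (P := fun c => 𝒯.IsClosedCell (𝒯.outCell d₀ c)) (n := n₀ - 1) (by omega) h
            rw [← hc] at this
            omega
          · have : j = n₀ := le_antisymm hjn hjn'
            rw [this] at h
            exact (not_open_of_isClosedCell hdisj h).1 hi'
      -- `c = t + q P` with `t < P`; `t` is a transition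
      obtain ⟨t, q, htP, hcq⟩ : ∃ t q, t < period h₀ ∧ c = t + q * period h₀ :=
        ⟨c % period h₀, c / period h₀, Nat.mod_lt _ hP0, (Nat.mod_add_div' c _).symm⟩
      have htT : t ∈ 𝒯.transitions d₀ h₀ := by
        refine Finset.mem_filter.2 ⟨Finset.mem_range.2 htP, ?_, ?_⟩
        · rw [← hcl_per t q, ← hcq]; exact hccl
        · rw [← hopen_per (t + 1) q, show t + 1 + q * period h₀ = c + 1 by rw [hcq]; ring]
          exact hopen_after (c + 1) (by omega) (by omega)
      -- the stretch `(t, m]`, `m := n₀ - q P`, is open and ends at a hub contact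
      obtain ⟨m, hmn⟩ : ∃ m, m + q * period h₀ = n₀ := ⟨n₀ - q * period h₀, by omega⟩
      have hm_hub : 𝒯.hubContact d₀ m := by rw [← hhub_per m q, hmn]; exact hi'
      have hm_att : v ∈ 𝒯.att (𝒯.outCell d₀ m) := by rw [← hout_per m q, hmn]; exact hv'
      have hm_open : ∀ j, t < j → j ≤ m → 𝒯.IsOpenSide d₀ j := by
        intro j h1 h2
        rw [← hopen_per j q]
        exact hopen_after _ (by omega) (by omega)
      have hgood : good t := ⟨m, by omega, hm_hub, hm_open⟩
      refine ⟨rep t, Finset.mem_image.2 ⟨t, htT, rfl⟩, ?_⟩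
      -- the first hub contact `n₁` after `t`
      have hrep : rep t = (𝒯.att_nonempty (Nat.find_spec hgood).2.1).choose := by
        simp only [rep, dif_pos hgood]
      obtain ⟨htn₁, hn₁hub, hn₁open⟩ := Nat.find_spec hgood
      have hn₁m : Nat.find hgood ≤ m := Nat.find_min' hgood ⟨by omega, hm_hub, hm_open⟩
      have hw : rep t ∈ 𝒯.att (𝒯.outCell d₀ (Nat.find hgood)) := by
        rw [hrep]; exact (𝒯.att_nonempty (Nat.find_spec hgood).2.1).choose_spec
      exact (hubConn_of_open_stretch' h₀ hT hfar hn₁m (fun l h1 h2 => hm_open l (by omega) h2) hn₁hub hm_hub hw hm_att).symm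

end Count


end TileData

end CellComplex

end Literature.Probability.Percolation

end
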